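import Literature.NumberTheory.Automorphic.ResGLnAdelicCoefficients
import Literature.NumberTheory.Automorphic.CoeffModuleIntegralForm
import HarnessLib

/-!
# The lattice `M_λ = ⨂_τ M_{λ_τ} ⊆ E_λ(k) = ⨂_τ V_{λ_τ}(k)` and its stability under integral
# finite-adelic points acting through place data

Topic `NumberTheory/Automorphic`; namespace `Literature.NumberTheory.Automorphic.ResGLnCohomology`
(that of `E_λ(k) = ResGLnCohomology.CoeffModule k n K λ`, `coeffRep`, `adelicCoeffRep`).  One
definition with a body and theorems; no named fact, no instance, no `sorry`.

For a subring `𝒪 ⊆ k`, the coefficient module `E_λ(k) = ⨂_{τ : K → k} V_{λ_τ}(k)` of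
`Res_{K/ℚ} GL_n` carries the integral form
`coeffIntForm k 𝒪 n K λ = ⨂_τ M_{λ_τ}` (`piTensorIntForm` of the integral forms
`GLnCohomology.coeffIntForm k 𝒪 n (λ τ) ⊆ V_{λ_τ}(k)` of `CoeffModuleIntegralForm`), which spans
`E_λ(k)` over `k` and is finitely generated over `𝒪` (`span_coeffIntForm_eq_top`, `coeffIntForm_fg`),
and — the point — is **stable under every finite-adelic `g` whose relevant local components act
through `GL_n(𝒪)`**: if `GL_n(φ_τ)(g_{v(τ)}) = g₀(τ) ∈ GL_n(𝒪)` for all `τ` then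
`adelicCoeffRep k n K λ v φ g` preserves `M_λ` (`adelicCoeffRep_mem_coeffIntForm`), and if moreover
`g₀(τ) ≡ 1 (mod I)` for all `τ` then `g x - x ∈ I • M_λ` (`adelicCoeffRep_sub_mem_smul_coeffIntForm`).
These are the two properties of the `ℤ̄_p`-lattice `M_ξ ⊆ ξ = ⊗_τ ξ_τ` used in
[Scholze2015, §V.4, proof of Thm. V.4.1] (stability under `K_p ⊆ GL_n(𝒪_{F,p})`, and "`K_p` is
sufficiently small so that `M_ξ/p^m` is trivial as a `K_p`-module"), here for place data `(v, φ)`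
in general; the specialisation to `ℚ̄_p`, the chosen `p`-adic places and the tame-level tower is
made where the tower is available.

## References

* P. Scholze, *On torsion in the cohomology of locally symmetric varieties*, Ann. of Math. 182
  (2015), §V.4 (arXiv:1306.2070, pp. 66–67). [Scholze2015]
* C. Khare, J. A. Thorne, Amer. J. Math. 139 (2017), §6.4 (`M_𝛌 = ⊗_τ M_{λ_τ}`). [KhareThorne2017]
-/

noncomputable section

open scoped NumberField TensorProduct
open IsDedekindDomain Literature.LinearAlgebra.BaseChange

namespace Literature.NumberTheory.Automorphic.ResGLnCohomology

open BigHeckeGLn GLnCohomology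

variable (k : Type) [Field k] (𝒪 : Subring k) (n : ℕ) (K : Type) [Field K] [NumberField K]
  (lam : (K →+* k) → Fin n → ℤ)

/-- **The lattice `M_λ = ⨂_τ M_{λ_τ} ⊆ E_λ(k)`**: the `𝒪`-span of the pure tensors of integral
vectors `w_τ ∈ M_{λ_τ} = GLnCohomology.coeffIntForm k 𝒪 n (λ τ)`.
[cite: Scholze2015, §V.4 (M_ξ, before Thm. V.4.1)] [cite: KhareThorne2017, §6.4 (M_𝛌)] -/
def coeffIntForm : Submodule 𝒪 (CoeffModule k n K lam) :=
  show Submodule 𝒪 (⨂[k] τ : (K →+* k), GLnCohomology.CoeffModule k n (lam τ)) from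
    piTensorIntForm 𝒪 fun τ : K →+* k => GLnCohomology.coeffIntForm k 𝒪 n (lam τ)

omit [NumberField K] in
/-- Pure tensors of integral vectors lie in `M_λ`. [folklore] -/
theorem tprod_mem_coeffIntForm {w : ∀ τ : K →+* k, GLnCohomology.CoeffModule k n (lam τ)}
    (hw : ∀ τ, w τ ∈ GLnCohomology.coeffIntForm k 𝒪 n (lam τ)) :
    CoeffModule.tprod w ∈ coeffIntForm k 𝒪 n K lam :=
  tprod_mem_piTensorIntForm hw

/-- **`M_λ` spans `E_λ(k)` over `k`** (`char k = 0`, so that there are finitely many `τ`).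
[cite: Scholze2015, §V.4 ("M_ξ[p⁻¹] = M_{ξ,K} ⊗ ℚ̄_p")] -/
theorem span_coeffIntForm_eq_top [CharZero k] :
    Submodule.span k (coeffIntForm k 𝒪 n K lam : Set (CoeffModule k n K lam)) = ⊤ :=
  span_piTensorIntForm_eq_top fun τ => GLnCohomology.span_coeffIntForm_eq_top k 𝒪 n (lam τ)

/-- **`M_λ` is finitely generated over `𝒪`** (`char k = 0`). [folklore] -/
theorem coeffIntForm_fg [CharZero k] : (coeffIntForm k 𝒪 n K lam).FG :=
  piTensorIntForm_fg fun τ => GLnCohomology.coeffIntForm_fg k 𝒪 n (lam τ)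

variable (v : (K →+* k) → HeightOneSpectrum (𝓞 K))
  (φ : ∀ τ : K →+* k, (v τ).adicCompletion K →+* k)

/-- **Stability of `M_λ`**: if every relevant local component of `g ∈ GL_n(𝔸_K^∞)` acts through an
`𝒪`-point, `GL_n(φ_τ)(g_{v(τ)}) = g₀(τ) ∈ GL_n(𝒪)`, then `adelicCoeffRep … g` preserves `M_λ`.
[cite: Scholze2015, §V.4 (proof of Thm. V.4.1: M_ξ is K_p-stable)] -/
theorem adelicCoeffRep_mem_coeffIntForm {g : FiniteAdelicGL n K} (g₀ : (K →+* k) → GL (Fin n) 𝒪)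
    (hg : ∀ τ, Matrix.GeneralLinearGroup.map (φ τ) (localComponent n K (v τ) g) =
      Matrix.GeneralLinearGroup.map 𝒪.subtype (g₀ τ))
    {x : CoeffModule k n K lam} (hx : x ∈ coeffIntForm k 𝒪 n K lam) :
    adelicCoeffRep k n K lam v φ g x ∈ coeffIntForm k 𝒪 n K lam := by
  rw [adelicCoeffRep_apply]
  exact map_mem_piTensorIntForm _ (fun τ w hw => by
    rw [hg τ]
    exact coeffRepGL_mem_coeffIntForm k 𝒪 n (lam τ) (g₀ τ) hw) hx

/-- **Congruences on `M_λ`**: if moreover `g₀(τ) ≡ 1 (mod I)` entrywise for all `τ`, then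
`g x - x ∈ I • M_λ` for every `x ∈ M_λ` — a level small enough at `p` acts trivially on `M_ξ / p^m`.
[cite: Scholze2015, §V.4 (proof of Thm. V.4.1)] -/
theorem adelicCoeffRep_sub_mem_smul_coeffIntForm [CharZero k] (I : Ideal 𝒪) {g : FiniteAdelicGL n K}
    (g₀ : (K →+* k) → GL (Fin n) 𝒪)
    (hg : ∀ τ, Matrix.GeneralLinearGroup.map (φ τ) (localComponent n K (v τ) g) =
      Matrix.GeneralLinearGroup.map 𝒪.subtype (g₀ τ))
    (hI : ∀ τ r c, ((g₀ τ : GL (Fin n) 𝒪) : Matrix (Fin n) (Fin n) 𝒪) r c -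
      (1 : Matrix (Fin n) (Fin n) 𝒪) r c ∈ I)
    {x : CoeffModule k n K lam} (hx : x ∈ coeffIntForm k 𝒪 n K lam) :
    adelicCoeffRep k n K lam v φ g x - x ∈ I • coeffIntForm k 𝒪 n K lam := by
  rw [adelicCoeffRep_apply]
  exact map_sub_mem_smul_piTensorIntForm I _
    (fun τ w hw => by
      rw [hg τ]
      exact coeffRepGL_mem_coeffIntForm k 𝒪 n (lam τ) (g₀ τ) hw)
    (fun τ w hw => by
      rw [hg τ]
      exact coeffRepGL_sub_mem_smul_coeffIntForm k 𝒪 n (lam τ) I (g₀ τ) (hI τ) hw) hx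

end Literature.NumberTheory.Automorphic.ResGLnCohomology
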